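import Summits.QuantumFields.YangMills.Theorems.AlphaInputsT3ACv3AbelianTensorBounds
import Summits.QuantumFields.YangMills.Theorems.AlphaInputsT3ACv3AbelianTensorSigma
import Summits.QuantumFields.YangMills.Theorems.AlphaInputsT3ACHistories
import HarnessLib

/-!
# `AlphaInputsT3ACv3AbelianRegionalLift` — STRATEGY B for 2′, (LL) THE LINEAR REGIONAL LIFT, part 1: THE LIFT AND ITS EXACTNESS — for a region `Ω ⊂ T_η` (a union of
# level-`k` blocks) and a level-`k` one-form `A`, the finest one-form `naive(A) + Σ_P [P ⊂ Ω](curl A)(P)·e_P + Σ_{C partial} φ_C·r_C^{θ(C)}` (gauge-fixed) has EXACT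
# `k`-fold linear (0.4)-averages `A` on EVERY level-`k` bond — lane `pub-balaban3d`, seat alpha-2 (g5)

WHY (OWNER DEPMAP v3.3; `…v3AbelianFineLift.fineLift_of_linearLift_abelian`, p581514): (FL) for abelian data ⇐ (LL).  THIS FILE: §1 the coefficients — the Ω-indicator of a
coarse plaquette, the three curls `F_{αβ}(y)`, the PARTIAL cubes (a corner block outside `Ω`) with a chosen outside corner `θ(C)`, and `φ_C = (d(1_Ω·curl A))(C)` (the
oriented sum of the Ω-face curls; zero for a cube with its eight corners in `Ω` by `dd = 0`); §2 the lift `liftT` and ★ `tubeSum_liftT : tubeSum k (liftT Ω A) = (L^k)³·A` on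
every bond (naive lift exact, every corrector invisible — `…v3AbelianTensorSums`); §3 the gauge-fixed lift `lift Ω A := liftT + cobd(Φ ∘ coarsen k)` and ★★
`linAvgIter_lift : linAvgIter k (lift Ω A) = A` (closed form of the `k`-fold average, `…v3AbelianLiftAvg`); §4 the bookkeeping identities of the curl computation (reindexing
the cube terms over the six faces; the corner lines against the naive curl).  The curl bound and the assembled (LL)/(FL) statements are in the sibling `…RegionalLiftCurl`.
HONEST FRAMING.  Kernel algebra; nothing of [B10]∕[7]∕[4] asserted; count-neutral helper toward R3 2′ (`stub_laneRecordsV3`, items 19935∕19936); registry untouched;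
nothing about d = 4, the continuum, or a mass gap.

References: T. Bałaban, Commun. Math. Phys. 102 (1985) 277–309 [Balaban1985Variational] ((2), (8) pp.278–279, (11)–(13) pp.279–280); CMP 109 (1987) 249–301
[Balaban1987RG1] ((0.4), (0.11) p.253).
-/

set_option autoImplicit false

noncomputable section

namespace Summit.QuantumFields.YangMills.Theorems.AbelianEML.Tensor

open scoped BigOperators
open Literature.MathematicalPhysics.QuantumFieldTheory.Balaban1983to89
open Literature.MathematicalPhysics.QuantumFieldTheory.Balaban1983to89.T3ContinuumYM3Torus
open Literature.MathematicalPhysics.QuantumFieldTheory.Balaban1983to89.BlockAveragingEMLProp2 (shift_shift_comm)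
open Literature.MathematicalPhysics.QuantumFieldTheory.Balaban1983to89.B10Eq38TorusDomains (toFine)
open Summit.QuantumFields.YangMills.Theorems.AbelianEML.Shapes1D
open Summit.QuantumFields.Balaban3D.Carriers (coarsen)

variable {F : T3Family} {K k : ℕ}

/-! ## §1 Coefficients: Ω-indicators, curls, partial cubes -/

section Coef

variable (F K k)
variable (Ω : Set (Site (F.P K) 0)) (A : PBond (F.P K) k → ℝ)

/-- The two directions of the plaquette orientation code: `0 ↔ (0,1)`, `1 ↔ (0,2)`, `2 ↔ (1,2)`. [folklore] -/
def dirs (αβ : Fin 3) : Fin 3 × Fin 3 := if αβ = 0 then ((0 : Fin 3), (1 : Fin 3)) else if αβ = 1 then ((0 : Fin 3), (2 : Fin 3)) else ((1 : Fin 3), (2 : Fin 3))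

/-- **THE COARSE PLAQUETTE `(y; α, β)` LIES IN `Ω`**: the representatives of its four corners do. [cite: Balaban1985UV3, p.267] -/
def PlaqIn (y : Site (F.P K) k) (α β : Fin 3) : Prop :=
  toFine k y ∈ Ω ∧ toFine k (y.shift α) ∈ Ω ∧ toFine k (y.shift β) ∈ Ω ∧ toFine k ((y.shift α).shift β) ∈ Ω

open scoped Classical in
/-- **THE COEFFICIENT OF THE PLAQUETTE CORRECTOR**: `[P ⊂ Ω]·(curl A)(P)`. [cite: Balaban1985Variational, (8) p.279] -/
def coef (αβ : Fin 3) (y : Site (F.P K) k) : ℝ :=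
  if PlaqIn F K k Ω y (dirs αβ).1 (dirs αβ).2 then curlAt A y (dirs αβ).1 (dirs αβ).2 else 0

/-- **A PARTIAL CUBE**: some corner block of the cube at `y` lies outside `Ω`. [cite: Balaban1985Variational, (8) p.279] -/
def Out (y : Site (F.P K) k) : Prop := ∃ θ : Fin 3 → Bool, toFine k (corner F K k θ y) ∉ Ω

open scoped Classical in
/-- **THE HOSTING CORNER** of a cube: an outside corner if there is one, else the home corner. [cite: Balaban1985Variational, (8) p.279] -/
def host (y : Site (F.P K) k) : Fin 3 → Bool := if h : Out F K k Ω y then Classical.choose h else θ0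

open scoped Classical in
/-- **THE CUBE COEFFICIENT** `φ_C = (d(1_Ω·curl A))(C)`: the oriented sum of the coefficients of the six faces. [cite: Balaban1985Variational, (8) p.279] -/
def phi (y : Site (F.P K) k) : ℝ :=
  (coef F K k Ω A 2 (y.shift (0 : Fin 3)) - coef F K k Ω A 2 y) - (coef F K k Ω A 1 (y.shift (1 : Fin 3)) - coef F K k Ω A 1 y) +
    (coef F K k Ω A 0 (y.shift (2 : Fin 3)) - coef F K k Ω A 0 y)

open scoped Classical in
/-- **THE LIFT BEFORE GAUGE FIXING**: `naive(A) + Σ_y Σ_{αβ} coef·e + Σ_{y partial} φ(y)·r^{host(y)}`. [cite: Balaban1985Variational, (8)+(11) p.279] -/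
def liftT : PBond (F.P K) 0 → ℝ := fun b =>
  naive F K k A b + ∑ y : Site (F.P K) k, (coef F K k Ω A 0 y * e01 F K k y b + coef F K k Ω A 1 y * e02 F K k y b + coef F K k Ω A 2 y * e12 F K k y b) +
    ∑ y : Site (F.P K) k, (if Out F K k Ω y then phi F K k Ω A y else 0) * rC F K k (host F K k Ω y) y b

end Coef

/-! ## §2 Exactness of the tube averages -/

section Exact

variable (Ω : Set (Site (F.P K) 0)) (A : PBond (F.P K) k → ℝ)

/-- The tube sum is additive. [folklore] -/
theorem tubeSum_add' (a b : PBond (F.P K) 0 → ℝ) (c : PBond (F.P K) k) : tubeSum k (fun e => a e + b e) c = tubeSum k a c + tubeSum k b c := by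
  simp only [tubeSum, Finset.sum_add_distrib]

/-- The tube sum of a linear combination over the level-`k` sites. [folklore] -/
theorem tubeSum_lincomb (w : Site (F.P K) k → ℝ) (a : Site (F.P K) k → PBond (F.P K) 0 → ℝ) (c : PBond (F.P K) k)
    (f : PBond (F.P K) 0 → ℝ) (hf : ∀ e, f e = ∑ y : Site (F.P K) k, w y * a y e) :
    tubeSum k f c = ∑ y : Site (F.P K) k, w y * tubeSum k (a y) c := by
  simp only [tubeSum, hf, Finset.mul_sum]
  exact (Finset.sum_congr rfl fun r _ => Finset.sum_comm).trans Finset.sum_comm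

open scoped Classical in
/-- **★ THE LIFT HAS EXACT TUBE AVERAGES ON EVERY BOND**: `tubeSum k (liftT Ω A) = (L^k)³·A`. [cite: Balaban1985Variational, (8)+(13) pp.279–280] -/
theorem tubeSum_liftT (hk : k ≤ K) (c : PBond (F.P K) k) : tubeSum k (liftT F K k Ω A) c = ((F.L : ℝ) ^ k) ^ 3 * A c := by
  obtain ⟨y', μ⟩ := c
  have h1 : tubeSum k (fun e => ∑ y : Site (F.P K) k, (coef F K k Ω A 0 y * e01 F K k y e + coef F K k Ω A 1 y * e02 F K k y e + coef F K k Ω A 2 y * e12 F K k y e))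
      ⟨y', μ⟩ = 0 := by
    have split : (fun e => ∑ y : Site (F.P K) k, (coef F K k Ω A 0 y * e01 F K k y e + coef F K k Ω A 1 y * e02 F K k y e + coef F K k Ω A 2 y * e12 F K k y e)) =
        fun e => (∑ y : Site (F.P K) k, coef F K k Ω A 0 y * e01 F K k y e) + ((∑ y : Site (F.P K) k, coef F K k Ω A 1 y * e02 F K k y e) +
          ∑ y : Site (F.P K) k, coef F K k Ω A 2 y * e12 F K k y e) := by
      funext e; simp only [Finset.sum_add_distrib]; ring
    rw [split, tubeSum_add', tubeSum_add', tubeSum_lincomb _ _ _ _ (fun e => rfl), tubeSum_lincomb _ _ _ _ (fun e => rfl), tubeSum_lincomb _ _ _ _ (fun e => rfl)]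
    simp [tubeSum_e01 hk, tubeSum_e02 hk, tubeSum_e12 hk]
  have h2 : tubeSum k (fun e => ∑ y : Site (F.P K) k, (if Out F K k Ω y then phi F K k Ω A y else 0) * rC F K k (host F K k Ω y) y e) ⟨y', μ⟩ = 0 := by
    rw [tubeSum_lincomb _ _ _ _ (fun e => rfl)]
    simp [tubeSum_rC hk]
  have h0 := tubeSum_naive hk A y' μ
  unfold liftT
  rw [tubeSum_add', tubeSum_add', h0, h1, h2, add_zero, add_zero]

end Exact

/-! ## §3 The gauge-fixed lift and its exact `k`-fold averages -/

section Gauge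

variable (F K k)
variable (Ω : Set (Site (F.P K) 0)) (A : PBond (F.P K) k → ℝ)

/-- **THE LIFT** `lift Ω A := liftT Ω A + cobd (Φ ∘ coarsen k)`, `Φ` the coboundary potential of the closed form of `linAvgIter k (liftT Ω A)` (standing range `k ≤ m + K`, which
`k ≤ K` implies). [cite: Balaban1987RG1, (0.4)+(0.11) p.253] -/
def lift (hk : k ≤ K) : PBond (F.P K) 0 → ℝ :=
  liftT F K k Ω A + cobd ((linAvgIter_eq_tubeSum_sub_cobd (P := F.P K) (le_standing hk) (liftT F K k Ω A)).choose ∘ coarsen k)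

variable {F K k}

/-- **★★ THE LIFT HAS EXACT `k`-FOLD LINEAR (0.4)-AVERAGES `A` ON EVERY LEVEL-`k` BOND.** [cite: Balaban1985Variational, (3)+(8) pp.278–279; Balaban1987RG1, (0.11) p.253] -/
theorem linAvgIter_lift (hk : k ≤ K) (c : PBond (F.P K) k) : linAvgIter k (lift F K k Ω A hk) c = A c := by
  have hΦ := (linAvgIter_eq_tubeSum_sub_cobd (P := F.P K) (le_standing hk) (liftT F K k Ω A)).choose_spec
  unfold lift
  rw [linAvgIter_gaugeFix (liftT F K k Ω A) _ hΦ _ (fun y => by simp only [Function.comp]; rw [coarsen_toFine k (le_standing hk)]) c,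
    tubeSum_liftT Ω A hk c]
  have hL : ((F.L : ℝ) ^ k) ≠ 0 := pow_ne_zero _ (by exact_mod_cast (zero_lt_one.trans F.hL.2).ne')
  show (((F.L : ℝ) ^ k) ^ 3)⁻¹ * (((F.L : ℝ) ^ k) ^ 3 * A c) = A c
  rw [← mul_assoc, inv_mul_cancel₀ (pow_ne_zero _ hL), one_mul]

/-- The curl of the lift is the curl of `liftT` (coboundaries have no curl). [folklore] -/
theorem curlAt_lift (hk : k ≤ K) (z : Site (F.P K) 0) (α β : Fin 3) : curlAt (lift F K k Ω A hk) z α β = curlAt (liftT F K k Ω A) z α β := by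
  unfold lift
  rw [curlAt_add, curlAt_cobd, add_zero]

end Gauge

/-! ## §4 Bookkeeping for the curl: reindexing over cubes, the corner lines, `dd = 0` -/

section Book

variable (Ω : Set (Site (F.P K) 0)) (A : PBond (F.P K) k → ℝ)

/-- Sums over the level-`k` sites are invariant under translation. [folklore] -/
theorem sum_shift (f : Site (F.P K) k → ℝ) (lam : Fin 3) : ∑ y : Site (F.P K) k, f (y.shift lam) = ∑ y : Site (F.P K) k, f y :=
  Fintype.sum_equiv (B10StarCount.shiftEquiv lam) _ _ (fun _ => rfl)

/-- **REINDEXING THE CUBE TERMS OVER THE SIX FACES**: `Σ_y [coef₀(K_y − K_{y−e₂}) − coef₁(K_y − K_{y−e₁}) + coef₂(K_y − K_{y−e₀})] = −Σ_y φ(y)·K_y`.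
[cite: Balaban1985Variational, (8) p.279] -/
theorem sum_faces_eq (hk : k ≤ K) (αβ : Fin 3) (z : Site (F.P K) 0) :
    ∑ y : Site (F.P K) k, (coef F K k Ω A 0 y * (Kc F K k θ0 0 αβ y z - Kc F K k θ0 (below F k 2) αβ y z) -
        coef F K k Ω A 1 y * (Kc F K k θ0 0 αβ y z - Kc F K k θ0 (below F k 1) αβ y z) +
        coef F K k Ω A 2 y * (Kc F K k θ0 0 αβ y z - Kc F K k θ0 (below F k 0) αβ y z)) =
      -∑ y : Site (F.P K) k, phi F K k Ω A y * Kc F K k θ0 0 αβ y z := by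
  simp only [Kc_below hk]
  have r0 : ∑ y : Site (F.P K) k, coef F K k Ω A 2 (y.shift (0 : Fin 3)) * Kc F K k θ0 0 αβ y z =
      ∑ y : Site (F.P K) k, coef F K k Ω A 2 y * Kc F K k θ0 0 αβ (y.unshift (0 : Fin 3)) z := by
    rw [← sum_shift (fun y => coef F K k Ω A 2 y * Kc F K k θ0 0 αβ (y.unshift (0 : Fin 3)) z) (0 : Fin 3)]
    exact Finset.sum_congr rfl fun y _ => by rw [Site.unshift_shift y (0 : Fin 3)]
  have r1 : ∑ y : Site (F.P K) k, coef F K k Ω A 1 (y.shift (1 : Fin 3)) * Kc F K k θ0 0 αβ y z =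
      ∑ y : Site (F.P K) k, coef F K k Ω A 1 y * Kc F K k θ0 0 αβ (y.unshift (1 : Fin 3)) z := by
    rw [← sum_shift (fun y => coef F K k Ω A 1 y * Kc F K k θ0 0 αβ (y.unshift (1 : Fin 3)) z) (1 : Fin 3)]
    exact Finset.sum_congr rfl fun y _ => by rw [Site.unshift_shift y (1 : Fin 3)]
  have r2 : ∑ y : Site (F.P K) k, coef F K k Ω A 0 (y.shift (2 : Fin 3)) * Kc F K k θ0 0 αβ y z =
      ∑ y : Site (F.P K) k, coef F K k Ω A 0 y * Kc F K k θ0 0 αβ (y.unshift (2 : Fin 3)) z := by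
    rw [← sum_shift (fun y => coef F K k Ω A 0 y * Kc F K k θ0 0 αβ (y.unshift (2 : Fin 3)) z) (2 : Fin 3)]
    exact Finset.sum_congr rfl fun y _ => by rw [Site.unshift_shift y (2 : Fin 3)]
  simp only [phi, mul_sub, sub_mul, add_mul, Finset.sum_add_distrib, Finset.sum_sub_distrib, ← r0, ← r1, ← r2]
  ring

/-- Three indicator factors, two of them guarded. [folklore] -/
theorem ind3 (P0 P1 P2 Q0 Q1 : Prop) [Decidable P0] [Decidable P1] [Decidable P2] [Decidable Q0] [Decidable Q1] :
    (if Q0 ∧ P0 then (1 : ℝ) else 0) * (if Q1 ∧ P1 then 1 else 0) * (if P2 then 1 else 0) =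
      if (Q0 ∧ Q1) then (if (P0 ∧ P1 ∧ P2) then 1 else 0) else 0 := by
  by_cases h0 : P0 <;> by_cases h1 : P1 <;> by_cases h2 : P2 <;> by_cases g0 : Q0 <;> by_cases g1 : Q1 <;> simp [h0, h1, h2, g0, g1]

/-- The crossing bond read from the offset: `c(ρ_i) = [z_i is the last label of its block ∧ its block is y_i]`. [folklore] -/
theorem c_rho_eq (hk : k ≤ K) (y : Site (F.P K) k) (z : Site (F.P K) 0) (i : Fin 3) :
    c_ F K k (rho y z i) = if ((z i).val % F.L ^ k = F.L ^ k - 1 ∧ (z i).val / F.L ^ k = (y i).val) then 1 else 0 := by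
  obtain ⟨h1, h2, h3⟩ := sizes (F := F) hk
  have hdvd : F.L ^ k ∣ N0 F K := ⟨nc F K k, h1⟩
  by_cases h : rho y z i % N0 F K = F.L ^ k - 1
  · have hz : (z i).val / F.L ^ k = (y i).val := div_eq_of_rho_lt hk y z i (by omega)
    have hm : (z i).val % F.L ^ k = F.L ^ k - 1 := by
      have e : (rho y z i + F.L ^ k * (y i).val) % N0 F K = (z i).val := by
        have hY : F.L ^ k * (y i).val ≤ N0 F K := by rw [h1]; exact Nat.mul_le_mul_left _ (ZMod.val_lt (y i)).le
        rw [rho, show (z i).val + (N0 F K - F.L ^ k * (y i).val) + F.L ^ k * (y i).val = (z i).val + N0 F K by omega, Nat.add_mod_right,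
          Nat.mod_eq_of_lt (ZMod.val_lt _)]
      rw [← e, Nat.mod_mod_of_dvd _ hdvd, Nat.add_mul_mod_self_left, ← Nat.mod_mod_of_dvd _ hdvd, h, Nat.mod_eq_of_lt (by omega)]
    simp only [c_, cS, per, h, if_true, hm, hz, and_self]
  · have hne : ¬ ((z i).val % F.L ^ k = F.L ^ k - 1 ∧ (z i).val / F.L ^ k = (y i).val) := by
      rintro ⟨hm, hz⟩
      apply h
      have hv := (Nat.div_add_mod (z i).val (F.L ^ k)).symm
      rw [hz, hm] at hv
      obtain ⟨cA, -⟩ := rho_mod_cases hk y z i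
      set m := F.L ^ k * (y i).val with hm'
      rw [cA (by omega), hv]; omega
    simp only [c_, cS, per, h, if_false, hne]

/-- The block indicator read from the offset: `b(ρ_i) = [the block of z_i is y_i]`. [folklore] -/
theorem b_rho_eq (hk : k ≤ K) (y : Site (F.P K) k) (z : Site (F.P K) 0) (i : Fin 3) :
    b_ F K k (rho y z i) = if (z i).val / F.L ^ k = (y i).val then 1 else 0 := by
  obtain ⟨h1, h2, h3⟩ := sizes (F := F) hk
  by_cases h : rho y z i % N0 F K < F.L ^ k
  · simp only [b_, bS, per, h, if_true, div_eq_of_rho_lt hk y z i h]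
  · have hne : ¬ ((z i).val / F.L ^ k = (y i).val) := by
      intro hz; apply h
      obtain ⟨cA, -⟩ := rho_mod_cases hk y z i
      have hle : F.L ^ k * (y i).val ≤ (z i).val := by
        have := Nat.div_mul_le_self (z i).val (F.L ^ k); rw [hz, mul_comm] at this; exact this
      have hlt : (z i).val < F.L ^ k * (y i).val + F.L ^ k := by
        have := Nat.lt_mul_div_succ (z i).val h3; rw [hz, Nat.mul_succ] at this; exact this
      set m := F.L ^ k * (y i).val with hm'
      rw [cA hle]; omega
    simp only [b_, bS, per, h, if_false, hne]

/-- The corner line at `(y; αβ)` as an indicator: both labels at the end of their blocks, and the block of `z` is `y`. [cite: Balaban1987RG1, (0.4) p.253] -/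
theorem cl_eq (hk : k ≤ K) (αβ : Fin 3) (y : Site (F.P K) k) (z : Site (F.P K) 0) :
    cl F K k αβ y z = if ((z (dirs αβ).1).val % F.L ^ k = F.L ^ k - 1 ∧ (z (dirs αβ).2).val % F.L ^ k = F.L ^ k - 1) then
      (if coarsen k z = y then 1 else 0) else 0 := by
  have hy : ∀ a b c : Fin 3, a ≠ b → a ≠ c → b ≠ c →
      (((z a).val / F.L ^ k = (y a).val ∧ (z b).val / F.L ^ k = (y b).val ∧ (z c).val / F.L ^ k = (y c).val) ↔ coarsen k z = y) := by
    intro a b c hab hac hbc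
    rw [coarsen_eq_iff hk]
    constructor
    · rintro ⟨ha, hb, hc⟩ i
      have : i = a ∨ i = b ∨ i = c := by fin_cases i <;> fin_cases a <;> fin_cases b <;> fin_cases c <;> simp_all
      rcases this with rfl | rfl | rfl
      · exact ha
      · exact hb
      · exact hc
    · intro h; exact ⟨h a, h b, h c⟩
  fin_cases αβ
  · simp only [cl, dirs, Fin.zero_eta, Fin.isValue, if_true, c_rho_eq hk, b_rho_eq hk, ind3]
    simp only [hy 0 1 2 (by decide) (by decide) (by decide)]
  · simp only [cl, dirs, Fin.mk_one, Fin.isValue, show ((1 : Fin 3) = 0) = False from by decide, if_true, if_false, c_rho_eq hk,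
      b_rho_eq hk]
    rw [show ∀ a b c : ℝ, a * b * c = a * c * b from fun a b c => by ring, ind3]
    simp only [hy 0 2 1 (by decide) (by decide) (by decide)]
  · simp only [cl, dirs, Fin.reduceFinMk, Fin.isValue, show ((2 : Fin 3) = 0) = False from by decide, show ((2 : Fin 3) = 1) = False from by decide,
      if_false, c_rho_eq hk, b_rho_eq hk]
    rw [show ∀ a b c : ℝ, a * b * c = b * c * a from fun a b c => by ring, ind3]
    simp only [hy 1 2 0 (by decide) (by decide) (by decide)]

/-- **THE CORNER LINES READ THE BLOCK OF THE PLAQUETTE**: `Σ_y coef_{αβ}(y)·cl_{αβ}(y, z)` is `coef_{αβ}(coarsen k z)` when both labels `z_α, z_β` are the last of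
their blocks, and `0` otherwise. [cite: Balaban1987RG1, (0.4) p.253] -/
theorem sum_cl_eq (hk : k ≤ K) (αβ : Fin 3) (z : Site (F.P K) 0) :
    ∑ y : Site (F.P K) k, coef F K k Ω A αβ y * cl F K k αβ y z =
      if ((z (dirs αβ).1).val % F.L ^ k = F.L ^ k - 1 ∧ (z (dirs αβ).2).val % F.L ^ k = F.L ^ k - 1) then coef F K k Ω A αβ (coarsen k z) else 0 := by
  simp only [cl_eq hk]
  split_ifs with h
  · simp only [mul_ite, mul_one, mul_zero]
    rw [Finset.sum_ite_eq Finset.univ (coarsen k z) (fun y => coef F K k Ω A αβ y)]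
    simp
  · simp

/-- **`dd = 0` ON THE COARSE LATTICE**: the oriented sum of the curls of the six faces of a cube vanishes. [cite: Balaban1985Averaging, (9) p.19] -/
theorem dd_zero (y : Site (F.P K) k) :
    (curlAt A (y.shift (0 : Fin 3)) (1 : Fin 3) (2 : Fin 3) - curlAt A y (1 : Fin 3) (2 : Fin 3)) -
      (curlAt A (y.shift (1 : Fin 3)) (0 : Fin 3) (2 : Fin 3) - curlAt A y (0 : Fin 3) (2 : Fin 3)) +
      (curlAt A (y.shift (2 : Fin 3)) (0 : Fin 3) (1 : Fin 3) - curlAt A y (0 : Fin 3) (1 : Fin 3)) = 0 := by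
  simp only [curlAt]
  rw [shift_shift_comm y (1 : Fin 3) (0 : Fin 3), shift_shift_comm y (2 : Fin 3) (0 : Fin 3), shift_shift_comm y (2 : Fin 3) (1 : Fin 3)]
  ring

/-- Extensionality of sites through the three coordinates. [folklore] -/
theorem site_ext3 {j : ℕ} {s t : Site (F.P K) j} (h0 : s (0 : Fin 3) = t (0 : Fin 3)) (h1 : s (1 : Fin 3) = t (1 : Fin 3)) (h2 : s (2 : Fin 3) = t (2 : Fin 3)) :
    s = t := by
  funext i
  match i with
  | ⟨0, _⟩ => exact h0
  | ⟨1, _⟩ => exact h1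
  | ⟨2, _⟩ => exact h2
  | ⟨n + 3, h⟩ => exact absurd h (by simp [T3Family.P_d])

/-- Shift by a Boolean. -/
def shB {j : ℕ} (y : Site (F.P K) j) (i : Fin 3) (t : Bool) : Site (F.P K) j := bif t then y.shift i else y

/-- **THE CORNERS OF A CUBE ARE ITS BOOLEAN SHIFTS**: `corner ![a,b,c] y = ((y +? e₀) +? e₁) +? e₂`. [folklore] -/
theorem corner_eq_shB (a b c : Bool) (y : Site (F.P K) k) : corner F K k ![a, b, c] y = shB (shB (shB y 0 a) 1 b) 2 c := by
  apply site_ext3 <;> cases a <;> cases b <;> cases c <;>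
    simp [corner, shB, Site.shift_apply]

/-- **A FULL CUBE HAS `φ = 0`**: if no corner block is outside `Ω`, all six faces are Ω-plaquettes and `φ_C = (dd curl A)(C) = 0`. [cite: Balaban1985Variational, (8) p.279] -/
theorem phi_eq_zero_of_not_out (y : Site (F.P K) k) (h : ¬ Out F K k Ω y) : phi F K k Ω A y = 0 := by
  have c : ∀ a b c : Bool, toFine k (shB (shB (shB y 0 a) 1 b) 2 c) ∈ Ω := fun a b c => by
    by_contra hc; exact h ⟨![a, b, c], by rw [corner_eq_shB]; exact hc⟩
  simp only [shB] at c
  have e10 : (y.shift (1 : Fin 3)).shift (0 : Fin 3) = (y.shift (0 : Fin 3)).shift (1 : Fin 3) := shift_shift_comm y 1 0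
  have e20 : (y.shift (2 : Fin 3)).shift (0 : Fin 3) = (y.shift (0 : Fin 3)).shift (2 : Fin 3) := shift_shift_comm y 2 0
  have e21 : (y.shift (2 : Fin 3)).shift (1 : Fin 3) = (y.shift (1 : Fin 3)).shift (2 : Fin 3) := shift_shift_comm y 2 1
  have e201 : ((y.shift (2 : Fin 3)).shift (0 : Fin 3)).shift (1 : Fin 3) = ((y.shift (0 : Fin 3)).shift (1 : Fin 3)).shift (2 : Fin 3) := by
    rw [e20]; exact shift_shift_comm (y.shift (0 : Fin 3)) (2 : Fin 3) (1 : Fin 3)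
  have e102 : ((y.shift (1 : Fin 3)).shift (0 : Fin 3)).shift (2 : Fin 3) = ((y.shift (0 : Fin 3)).shift (1 : Fin 3)).shift (2 : Fin 3) := by rw [e10]
  have P2y : PlaqIn F K k Ω y (1 : Fin 3) (2 : Fin 3) := ⟨c false false false, c false true false, c false false true, c false true true⟩
  have P2s : PlaqIn F K k Ω (y.shift (0 : Fin 3)) (1 : Fin 3) (2 : Fin 3) := ⟨c true false false, c true true false, c true false true, c true true true⟩
  have P1y : PlaqIn F K k Ω y (0 : Fin 3) (2 : Fin 3) := ⟨c false false false, c true false false, c false false true, c true false true⟩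
  have P1s : PlaqIn F K k Ω (y.shift (1 : Fin 3)) (0 : Fin 3) (2 : Fin 3) :=
    ⟨c false true false, by rw [e10]; exact c true true false, c false true true, by rw [e102]; exact c true true true⟩
  have P0y : PlaqIn F K k Ω y (0 : Fin 3) (1 : Fin 3) := ⟨c false false false, c true false false, c false true false, c true true false⟩
  have P0s : PlaqIn F K k Ω (y.shift (2 : Fin 3)) (0 : Fin 3) (1 : Fin 3) :=
    ⟨c false false true, by rw [e20]; exact c true false true, by rw [e21]; exact c false true true, by rw [e201]; exact c true true true⟩
  simp only [phi, coef, dirs, Fin.isValue, if_true, if_false, show ((1 : Fin 3) = 0) = False from by decide,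
    show ((2 : Fin 3) = 0) = False from by decide, show ((2 : Fin 3) = 1) = False from by decide, P2y, P2s, P1y, P1s, P0y, P0s]
  exact dd_zero A y

end Book

end Summit.QuantumFields.YangMills.Theorems.AbelianEML.Tensor

end
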